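import Mathlib
import Literature.MathematicalPhysics.StatisticalMechanics.Crystallization
import Literature.MathematicalPhysics.StatisticalMechanics.LennardJonesClusters

/-!
# Diagonal choice of typical centres (stub `stub_diagonalCentres` of crux
# `HcpDiffractionRigidity`, item `stmt-AtomisticToContinuum-13166`, line `registered`)

**Pure bookkeeping (stub A4 of Half A).**  From the hard core, the pair statistics `S2` of the
crux, and the conclusions of the three analytic stubs A1 (DENSE: few particles have small Gaussian
mass), A2 (QUIET: few dense particles have loud Gaussian windows, for each admissible test
function) and A3 (APPROX: a countable family of admissible test functions approximating every
admissible one uniformly in the windowed intensity of separated weighted configurations), taken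
as hypotheses, we choose one particle centre per `N` and recentre there, obtaining a recentred
sequence with asymptotically exact windows and Gaussian-quiet windows along scales `L t → ∞`.

No integral is ever evaluated: `HcpRigidityDiagonalCentres.diagonalCentres_core` is stated for
an arbitrary weight `w`, an arbitrary intensity functional `I` and an arbitrary admissibility
predicate `A`.
The countably many constraints (exact `k`-windows with tolerance `1/(k+1)`, `k : ℕ`; density at
scale `L t`, `t : ℕ`; quietness of family member `m` at scale `L t`, `m ≤ t`) are indexed by the
encodable type `ℕ ⊕ ℕ ⊕ ℕ × ℕ` and given budgets `2^{-(encode c + 2)}` (finite sums `≤ 1/2`,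
`sum_half_pow_encode_le`).  Each constraint is violated, eventually in `N`, by at most
budget `× N` centres: for density and quietness this is the hypothesis, for exact windows it is
Markov on `S2` together with the packing count `card_badCentres_le` (a bad pair at range `2k`
spoils at most `(2k/δ+1)³` centres).  Activating at stage `N` only the constraints with code
`≤ N` whose eventual bound is already in force, the active bad sets cover at most half of the
indices, so a good centre exists (`exists_goodCentre`), and every fixed constraint is active from
some stage on.  Recentring at the good centre (`φ j = j + 1`, `τ j = -x_{ctr j}`) and reaching a
general admissible `h` through the family member given by APPROX finishes the proof.
All `[folklore]`.
-/

noncomputable section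

namespace Summit.AtomisticToContinuum.Crystallization.Theorems

open Filter Finset
open scoped BigOperators Classical
open Literature.MathematicalPhysics.StatisticalMechanics

namespace HcpRigidityDiagonalCentres

/-- Finite sums of the geometric weights `2^{-encode c}` over an encodable type are `≤ 2`.
[folklore] -/
theorem sum_half_pow_encode_le {ι : Type*} [Encodable ι] (s : Finset ι) :
    ∑ c ∈ s, (1 / 2 : ℝ) ^ Encodable.encode c ≤ 2 := by
  obtain ⟨M, hM⟩ := (s.image Encodable.encode).exists_nat_subset_range
  calc ∑ c ∈ s, (1 / 2 : ℝ) ^ Encodable.encode c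
        = ∑ n ∈ s.image Encodable.encode, (1 / 2 : ℝ) ^ n := by
          rw [Finset.sum_image fun a _ b _ h => Encodable.encode_injective h]
    _ ≤ ∑ n ∈ Finset.range M, (1 / 2 : ℝ) ^ n :=
          Finset.sum_le_sum_of_subset_of_nonneg hM fun n _ _ => by positivity
    _ ≤ 2 := sum_geometric_two_le M

/-- **Diagonal activation of countably many constraints.** Suppose that for every constraint `c`
of an encodable family the set `bad c N` of indices violating `c` at stage `N` eventually has at
most `2^{-(encode c + 2)} N` elements.  Then one can pick an index `ctr N : Fin (N + 1)` at every
stage such that every fixed constraint is eventually satisfied by the picked index: at stage `N`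
only the constraints with `encode c ≤ N` whose eventual bound is already in force are imposed, and
their bad sets cover at most half of the `N + 1` indices. [folklore] -/
theorem exists_goodCentre {ι : Type*} [Encodable ι] (bad : ι → (N : ℕ) → Finset (Fin N))
    (hev : ∀ c, ∀ᶠ N : ℕ in atTop,
      ((bad c N).card : ℝ) ≤ (1 / 2 : ℝ) ^ (Encodable.encode c + 2) * N) :
    ∃ ctr : (N : ℕ) → Fin (N + 1), ∀ c, ∀ᶠ N : ℕ in atTop, ctr N ∉ bad c (N + 1) := by
  choose T hT using fun c => Filter.eventually_atTop.1 (hev c)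
  -- constraints active at stage `N`
  set Act : ℕ → Finset ι := fun N =>
    ((Finset.range (N + 1)).preimage Encodable.encode
      Encodable.encode_injective.injOn).filter (fun c => T c ≤ N) with hAct
  have hB : ∀ N : ℕ, (((Act (N + 1)).biUnion fun c => bad c (N + 1)).card : ℝ) < N + 1 := by
    intro N
    have hN : (0 : ℝ) < N + 1 := by positivity
    calc (((Act (N + 1)).biUnion fun c => bad c (N + 1)).card : ℝ)
          ≤ ∑ c ∈ Act (N + 1), ((bad c (N + 1)).card : ℝ) := by
            exact_mod_cast Finset.card_biUnion_le
      _ ≤ ∑ c ∈ Act (N + 1), (1 / 2 : ℝ) ^ (Encodable.encode c + 2) * ((N + 1 : ℕ) : ℝ) :=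
            Finset.sum_le_sum fun c hc => hT c (N + 1) (Finset.mem_filter.1 hc).2
      _ = (∑ c ∈ Act (N + 1), (1 / 2 : ℝ) ^ Encodable.encode c) * (1 / 4 * (N + 1)) := by
            rw [Finset.sum_mul]
            refine Finset.sum_congr rfl fun c _ => ?_
            push_cast
            ring
      _ ≤ 2 * (1 / 4 * (N + 1)) := by gcongr; exact sum_half_pow_encode_le _
      _ < N + 1 := by linarith
  have hex : ∀ N : ℕ, ∃ i : Fin (N + 1), i ∉ (Act (N + 1)).biUnion fun c => bad c (N + 1) := by
    intro N
    have h : ((Act (N + 1)).biUnion fun c => bad c (N + 1)).card <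
        (Finset.univ : Finset (Fin (N + 1))).card := by
      rw [Finset.card_univ, Fintype.card_fin]; exact_mod_cast hB N
    obtain ⟨i, -, hi⟩ := Finset.exists_mem_notMem_of_card_lt_card h
    exact ⟨i, hi⟩
  choose ctr hctr using hex
  refine ⟨ctr, fun c => Filter.eventually_atTop.2
    ⟨max (Encodable.encode c) (T c), fun N hN hmem => ?_⟩⟩
  have h1 : Encodable.encode c ≤ N := (le_max_left _ _).trans hN
  have h2 : T c ≤ N := (le_max_right _ _).trans hN
  refine hctr N (Finset.mem_biUnion.2 ⟨c, ?_, hmem⟩)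
  simp only [hAct, Finset.mem_filter, Finset.mem_preimage, Finset.mem_range]
  exact ⟨by omega, by omega⟩

/-- **A bad pair spoils few centres (packing).** For a `δ`-separated configuration `y` in `ℝ³`
and an arbitrary pair property `Q`, the number of centres `i` seeing two distinct points `i', i''`
within distance `k` with `Q i' i''` is at most `(2k/δ + 1)³` times the number of ordered pairs at
mutual distance `≤ 2k` with `Q`: such a pair lies within `k` of at most `(2k/δ + 1)³` centres by
the volume packing bound. [folklore] -/
theorem card_badCentres_le {N : ℕ} (y : Fin N → EuclideanSpace ℝ (Fin 3)) {δ : ℝ} (hδ : 0 < δ)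
    (hsep : ∀ i j : Fin N, i ≠ j → δ ≤ dist (y i) (y j)) (Q : Fin N → Fin N → Prop) {k : ℝ}
    (hk : 0 ≤ k) :
    ((Finset.univ.filter fun i : Fin N => ∃ i' i'' : Fin N, i' ≠ i'' ∧ dist (y i') (y i) ≤ k ∧
        dist (y i'') (y i) ≤ k ∧ Q i' i'').card : ℝ) ≤
      (2 * k / δ + 1) ^ 3 *
        Nat.card {p : Fin N × Fin N // p.1 ≠ p.2 ∧ dist (y p.1) (y p.2) ≤ 2 * k ∧ Q p.1 p.2} := by
  -- packing: at most `(2k/δ+1)³` points of `y` within `k` of any point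
  have hpack : ∀ p : EuclideanSpace ℝ (Fin 3),
      ((Finset.univ.filter fun i : Fin N => dist (y i) p ≤ k).card : ℝ) ≤ (2 * k / δ + 1) ^ 3 := by
    intro p
    have hinj : Function.Injective y := fun i j h => by
      by_contra hij
      have := hsep i j hij
      rw [h, dist_self] at this
      linarith
    have := card_le_of_separated_of_dist_le
      ((Finset.univ.filter fun i : Fin N => dist (y i) p ≤ k).image y) p hδ hk
      (by
        simp only [Finset.mem_image, Finset.mem_filter, Finset.mem_univ, true_and]
        rintro _ ⟨i, hi, rfl⟩
        exact hi)
      (by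
        simp only [Finset.mem_image, Finset.mem_filter, Finset.mem_univ, true_and]
        rintro _ ⟨i, -, rfl⟩ _ ⟨j, -, rfl⟩ hij
        exact hsep i j fun h => hij (h ▸ rfl))
    rwa [Finset.card_image_of_injective _ hinj, finrank_euclideanSpace, Fintype.card_fin] at this
  rw [Nat.card_eq_fintype_card, Fintype.card_subtype]
  set BP := Finset.univ.filter fun p : Fin N × Fin N =>
    p.1 ≠ p.2 ∧ dist (y p.1) (y p.2) ≤ 2 * k ∧ Q p.1 p.2 with hBP
  set BC := Finset.univ.filter fun i : Fin N => ∃ i' i'' : Fin N, i' ≠ i'' ∧ dist (y i') (y i) ≤ k ∧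
    dist (y i'') (y i) ≤ k ∧ Q i' i'' with hBC
  -- double counting of the incidences `(i, p)` with `p` a bad pair within `k` of `i`
  have h1 : BC.card ≤ ∑ p ∈ BP, (Finset.univ.filter fun i : Fin N => dist (y i) (y p.1) ≤ k).card :=
    calc BC.card = ∑ i ∈ BC, 1 := Finset.card_eq_sum_ones _
      _ ≤ ∑ i ∈ BC, (BP.filter fun p => dist (y i) (y p.1) ≤ k).card := by
          refine Finset.sum_le_sum fun i hi => ?_
          obtain ⟨i', i'', hne, h1, h2, hQ⟩ := (Finset.mem_filter.1 hi).2
          refine Finset.card_pos.2 ⟨(i', i''), Finset.mem_filter.2 ⟨Finset.mem_filter.2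
            ⟨Finset.mem_univ _, hne, ?_, hQ⟩, ?_⟩⟩
          · calc dist (y i') (y i'') ≤ dist (y i') (y i) + dist (y i) (y i'') := dist_triangle _ _ _
              _ ≤ k + k := add_le_add h1 (by rwa [dist_comm])
              _ = 2 * k := by ring
          · show dist (y i) (y i') ≤ k
            rwa [dist_comm]
      _ ≤ ∑ i, (BP.filter fun p => dist (y i) (y p.1) ≤ k).card :=
          Finset.sum_le_sum_of_subset_of_nonneg (Finset.subset_univ _) fun _ _ _ => Nat.zero_le _
      _ = ∑ p ∈ BP, (Finset.univ.filter fun i : Fin N => dist (y i) (y p.1) ≤ k).card := by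
          simp only [Finset.card_filter]
          exact Finset.sum_comm
  calc (BC.card : ℝ)
        ≤ ∑ p ∈ BP, ((Finset.univ.filter fun i : Fin N => dist (y i) (y p.1) ≤ k).card : ℝ) := by
          exact_mod_cast h1
    _ ≤ ∑ p ∈ BP, (2 * k / δ + 1) ^ 3 := Finset.sum_le_sum fun p _ => hpack (y p.1)
    _ = (2 * k / δ + 1) ^ 3 * BP.card := by rw [Finset.sum_const, nsmul_eq_mul, mul_comm]

/-- **Bookkeeping core of stub A4 (diagonal choice of typical centres), abstract form.**
The weights `w L v` (Gaussian `e^{-|v|²/L²}` in the application), the windowed intensity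
functional `I h n y c` (there `∫ h |∑ cᵢ e^{2πi⟨ξ,yᵢ⟩}|²`) and the admissibility predicate `A`
are arbitrary: only the hard core, the pair statistics `S2`, and the three inputs DENSE, QUIET and
APPROX are used.  Constraints (exact `k`-windows with tolerance `1/(k+1)`; density at scale `L t`;
quietness of family member `m` at scale `L t`, `m ≤ t`) are indexed by the encodable type
`ℕ ⊕ ℕ ⊕ ℕ × ℕ` with budgets `2^{-(encode + 2)}`; the density thresholds `θ t` and scales
`L t ≥ t` are chosen first, then `exists_goodCentre` picks the centres, and the conclusions are
read off (the exact-window count is `card_badCentres_le` + Markov on `S2`; general admissible `h`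
are reached through the family by APPROX). [folklore] -/
theorem diagonalCentres_core {S : Set (EuclideanSpace ℝ (Fin 3))} {δ : ℝ} (hδ : 0 < δ)
    (x : (N : ℕ) → (Fin N → EuclideanSpace ℝ (Fin 3)))
    (HC : ∀ (N : ℕ) (i j : Fin N), i ≠ j → δ ≤ dist (x N i) (x N j))
    (S2 : ∀ R η : ℝ, 0 < η → Tendsto (fun N : ℕ => (Nat.card {p : Fin N × Fin N // p.1 ≠ p.2 ∧
      dist (x N p.1) (x N p.2) ≤ R ∧ ∀ a ∈ S, ∀ b ∈ S, η ≤ |dist (x N p.1) (x N p.2) - dist a b|}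
        : ℝ) / N) atTop (nhds 0))
    {H : Type*} (A : H → Prop)
    (I : H → (n : ℕ) → (Fin n → EuclideanSpace ℝ (Fin 3)) → (Fin n → ℝ) → ℝ)
    (w : ℝ → EuclideanSpace ℝ (Fin 3) → ℝ)
    (DENSE : ∀ ε : ℝ, 0 < ε → ∃ θ : ℝ, 0 < θ ∧ ∃ L₀ : ℝ, ∀ L : ℝ, L₀ ≤ L → ∀ᶠ N : ℕ in atTop,
      ((Finset.univ.filter fun i : Fin N =>
        ∑ j, w L (x N j - x N i) ^ 2 < θ * L ^ 3).card : ℝ) ≤ ε * N)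
    (QUIET : ∀ h, A h → ∀ ε θ : ℝ, 0 < ε → 0 < θ → ∃ L₁ : ℝ, ∀ L : ℝ, L₁ ≤ L →
      ∀ᶠ N : ℕ in atTop, ((Finset.univ.filter fun i : Fin N =>
        θ * L ^ 3 ≤ ∑ j, w L (x N j - x N i) ^ 2 ∧
        ε * ∑ j, w L (x N j - x N i) ^ 2 <
          I h N (fun j => x N j - x N i) (fun j => w L (x N j - x N i))).card : ℝ) ≤ ε * N)
    (APPROX : ∃ hf : ℕ → H, (∀ m, A (hf m)) ∧ ∀ h, A h → ∀ ε : ℝ, 0 < ε → ∃ m : ℕ,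
      ∀ (n : ℕ) (y : Fin n → EuclideanSpace ℝ (Fin 3)) (c : Fin n → ℝ),
        (∀ i j, i ≠ j → δ ≤ dist (y i) (y j)) → |I h n y c - I (hf m) n y c| ≤ ε * ∑ i, c i ^ 2) :
    ∃ ctr : (N : ℕ) → Fin (N + 1),
      (∀ R η : ℝ, 0 < η → ∀ᶠ N : ℕ in atTop, ∀ i i' : Fin (N + 1), i ≠ i' →
        dist (x (N + 1) i) (x (N + 1) (ctr N)) ≤ R → dist (x (N + 1) i') (x (N + 1) (ctr N)) ≤ R →
        ∃ a ∈ S, ∃ b ∈ S, |dist (x (N + 1) i) (x (N + 1) i') - dist a b| < η) ∧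
      ∃ L : ℕ → ℝ, Tendsto L atTop atTop ∧ ∀ h, A h → ∀ ε : ℝ, 0 < ε →
        ∀ᶠ t : ℕ in atTop, ∀ᶠ N : ℕ in atTop,
          I h (N + 1) (fun i => x (N + 1) i - x (N + 1) (ctr N))
              (fun i => w (L t) (x (N + 1) i - x (N + 1) (ctr N))) ≤
            ε * ∑ i, w (L t) (x (N + 1) i - x (N + 1) (ctr N)) ^ 2 := by
  obtain ⟨hf, hfA, hfapp⟩ := APPROX
  -- constraints `ℕ ⊕ ℕ ⊕ ℕ × ℕ`: `inl k` exact windows, `inr (inl t)` density at scale `L t`,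
  -- `inr (inr (m, t))` quietness of `hf m` at scale `L t`; budgets `β`
  set β : ℕ ⊕ ℕ ⊕ ℕ × ℕ → ℝ := fun c => (1 / 2 : ℝ) ^ (Encodable.encode c + 2) with hβ
  have hβ0 : ∀ c, 0 < β c := fun c => by positivity
  -- density thresholds and scales
  choose θ hθ L₀ hD using fun t : ℕ => DENSE (β (Sum.inr (Sum.inl t))) (hβ0 _)
  choose L₁ hQ using fun m t : ℕ =>
    QUIET (hf m) (hfA m) (β (Sum.inr (Sum.inr (m, t)))) (θ t) (hβ0 _) (hθ t)
  set L : ℕ → ℝ := fun t => max (t : ℝ) (max (L₀ t)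
    ((Finset.range (t + 1)).sup' ⟨0, by simp⟩ fun m => L₁ m t)) with hL
  have hLt : ∀ t : ℕ, (t : ℝ) ≤ L t := fun t => le_max_left _ _
  have hLL₀ : ∀ t, L₀ t ≤ L t := fun t => (le_max_left _ _).trans (le_max_right _ _)
  have hLL₁ : ∀ m t, m ≤ t → L₁ m t ≤ L t := fun m t hmt =>
    ((Finset.le_sup' (fun m => L₁ m t) (Finset.mem_range.2 (Nat.lt_succ_of_le hmt))).trans
      (le_max_right _ _)).trans (le_max_right _ _)
  -- bad sets
  set badE : ℕ → (N : ℕ) → Finset (Fin N) := fun k N => Finset.univ.filter fun i : Fin N =>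
    ∃ i' i'' : Fin N, i' ≠ i'' ∧ dist (x N i') (x N i) ≤ k ∧ dist (x N i'') (x N i) ≤ k ∧
      ∀ a ∈ S, ∀ b ∈ S, 1 / ((k : ℝ) + 1) ≤ |dist (x N i') (x N i'') - dist a b| with hbadE
  set badS : ℕ → (N : ℕ) → Finset (Fin N) := fun t N => Finset.univ.filter fun i : Fin N =>
    ∑ j, w (L t) (x N j - x N i) ^ 2 < θ t * L t ^ 3 with hbadS
  set badQ : ℕ × ℕ → (N : ℕ) → Finset (Fin N) := fun p N => if p.1 ≤ p.2 then
    Finset.univ.filter fun i : Fin N =>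
      θ p.2 * L p.2 ^ 3 ≤ ∑ j, w (L p.2) (x N j - x N i) ^ 2 ∧
      β (Sum.inr (Sum.inr p)) * ∑ j, w (L p.2) (x N j - x N i) ^ 2 <
        I (hf p.1) N (fun j => x N j - x N i) (fun j => w (L p.2) (x N j - x N i)) else ∅
    with hbadQ
  set bad : ℕ ⊕ ℕ ⊕ ℕ × ℕ → (N : ℕ) → Finset (Fin N) := Sum.elim badE (Sum.elim badS badQ)
    with hbad
  -- Markov on `S2` + packing: the exact-window constraints have eventually small bad sets
  have hevE : ∀ k : ℕ, ∀ᶠ N : ℕ in atTop, ((badE k N).card : ℝ) ≤ β (Sum.inl k) * N := by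
    intro k
    set C : ℝ := (2 * (k : ℝ) / δ + 1) ^ 3 with hC
    have hC0 : 0 < C := by positivity
    have h1 := (S2 (2 * k) (1 / ((k : ℝ) + 1)) (by positivity)).eventually_lt_const
      (show (0 : ℝ) < β (Sum.inl k) / C by positivity)
    filter_upwards [h1, eventually_gt_atTop 0] with N hN hN0
    have hN0' : (0 : ℝ) < N := by exact_mod_cast hN0
    rw [div_lt_iff₀ hN0'] at hN
    calc ((badE k N).card : ℝ) ≤ C * Nat.card {p : Fin N × Fin N // p.1 ≠ p.2 ∧
          dist (x N p.1) (x N p.2) ≤ 2 * k ∧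
            ∀ a ∈ S, ∀ b ∈ S, 1 / ((k : ℝ) + 1) ≤ |dist (x N p.1) (x N p.2) - dist a b|} :=
          card_badCentres_le (x N) hδ (HC N)
            (fun i' i'' => ∀ a ∈ S, ∀ b ∈ S,
              1 / ((k : ℝ) + 1) ≤ |dist (x N i') (x N i'') - dist a b|) (Nat.cast_nonneg k)
      _ ≤ C * (β (Sum.inl k) / C * N) := by gcongr
      _ = β (Sum.inl k) * N := by field_simp
  have hev : ∀ c, ∀ᶠ N : ℕ in atTop,
      ((bad c N).card : ℝ) ≤ (1 / 2 : ℝ) ^ (Encodable.encode c + 2) * N := by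
    rintro (k | t | ⟨m, t⟩)
    · exact hevE k
    · exact hD t (L t) (hLL₀ t)
    · by_cases hmt : m ≤ t
      · simp only [hbad, hbadQ, Sum.elim_inr, if_pos hmt]
        exact hQ m t (L t) (hLL₁ m t hmt)
      · simp only [hbad, hbadQ, Sum.elim_inr, if_neg hmt, Finset.card_empty, Nat.cast_zero]
        exact Filter.Eventually.of_forall fun N => by positivity
  obtain ⟨ctr, hctr⟩ := exists_goodCentre bad hev
  refine ⟨ctr, ?_, L, tendsto_atTop_mono hLt tendsto_natCast_atTop_atTop, ?_⟩
  · -- asymptotically exact windows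
    intro R η hη
    obtain ⟨k, hk⟩ := exists_nat_gt (max R (1 / η))
    have hRk : R ≤ k := (le_max_left _ _).trans hk.le
    have hkη : 1 / ((k : ℝ) + 1) < η := by
      have h1 : 1 / η < k := (le_max_right _ _).trans_lt hk
      rw [div_lt_iff₀ hη] at h1
      rw [div_lt_iff₀ (by positivity)]
      nlinarith
    filter_upwards [hctr (Sum.inl k)] with N hN i i' hii' hi hi'
    by_contra hcon
    push Not at hcon
    exact hN (Finset.mem_filter.2 ⟨Finset.mem_univ _, i, i', hii', hi.trans hRk, hi'.trans hRk,
      fun a ha b hb => hkη.le.trans (hcon a ha b hb)⟩)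
  · -- quiet windows for every admissible `h`
    intro h hA ε hε
    obtain ⟨m, hm⟩ := hfapp h hA (ε / 2) (half_pos hε)
    obtain ⟨T, hT⟩ := exists_pow_lt_of_lt_one (half_pos hε) (by norm_num : (1 / 2 : ℝ) < 1)
    filter_upwards [eventually_ge_atTop (max m T)] with t ht
    have hmt : m ≤ t := (le_max_left _ _).trans ht
    have hTt : T ≤ t := (le_max_right _ _).trans ht
    filter_upwards [hctr (Sum.inr (Sum.inl t)), hctr (Sum.inr (Sum.inr (m, t)))] with N hN1 hN2
    set c := ctr N with hc
    set M := ∑ i, w (L t) (x (N + 1) i - x (N + 1) c) ^ 2 with hM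
    have hM0 : 0 ≤ M := Finset.sum_nonneg fun i _ => sq_nonneg _
    have h1 : θ t * L t ^ 3 ≤ M := by
      by_contra hlt
      push Not at hlt
      exact hN1 (Finset.mem_filter.2 ⟨Finset.mem_univ _, hlt⟩)
    have h2 : I (hf m) (N + 1) (fun i => x (N + 1) i - x (N + 1) c)
        (fun i => w (L t) (x (N + 1) i - x (N + 1) c)) ≤ β (Sum.inr (Sum.inr (m, t))) * M := by
      by_contra hlt
      push Not at hlt
      apply hN2
      simp only [hbad, hbadQ, Sum.elim_inr, if_pos hmt]
      exact Finset.mem_filter.2 ⟨Finset.mem_univ _, h1, hlt⟩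
    have h3 := hm (N + 1) (fun i => x (N + 1) i - x (N + 1) c)
      (fun i => w (L t) (x (N + 1) i - x (N + 1) c))
      (fun i j hij => by rw [dist_sub_right]; exact HC (N + 1) i j hij)
    have h3' : I h (N + 1) (fun i => x (N + 1) i - x (N + 1) c)
          (fun i => w (L t) (x (N + 1) i - x (N + 1) c)) -
        I (hf m) (N + 1) (fun i => x (N + 1) i - x (N + 1) c)
          (fun i => w (L t) (x (N + 1) i - x (N + 1) c)) ≤ ε / 2 * M := (abs_sub_le_iff.1 h3).1
    have hβle : β (Sum.inr (Sum.inr (m, t))) ≤ ε / 2 := by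
      have henc : t ≤ Encodable.encode (Sum.inr (Sum.inr (m, t)) : ℕ ⊕ ℕ ⊕ ℕ × ℕ) := by
        simp only [Encodable.encode_inr, Encodable.encode_prod_val, Encodable.encode_nat]
        have := Nat.right_le_pair m t
        omega
      calc β (Sum.inr (Sum.inr (m, t)))
            = (1 / 2 : ℝ) ^ (Encodable.encode (Sum.inr (Sum.inr (m, t)) : ℕ ⊕ ℕ ⊕ ℕ × ℕ) + 2) :=
              rfl
        _ ≤ (1 / 2 : ℝ) ^ T := pow_le_pow_of_le_one (by norm_num) (by norm_num) (by omega)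
        _ ≤ ε / 2 := hT.le
    have h4 : β (Sum.inr (Sum.inr (m, t))) * M ≤ ε / 2 * M := mul_le_mul_of_nonneg_right hβle hM0
    linarith

end HcpRigidityDiagonalCentres

/-- **STUB A4 — diagonal choice of typical centres (bookkeeping).** From the hard core, the crux
hypothesis S2, and the conclusions of stubs A1 (dense centres), A2 (quiet centres) and A3
(approximating family) taken as hypotheses, Goal A follows: a recentred subsequence (here
`φ j = j + 1`, centred at a well-chosen particle) with asymptotically exact windows and, along
scales `L t → ∞`, Gaussian-quiet windows for every admissible test function. [folklore] -/
theorem stub_diagonalCentres : ∀ (P : Literature.MathematicalPhysics.StatisticalMechanics.PeriodicConfiguration 3) (δ : ℝ), 0 < δ → ∀ x : (N : ℕ) → (Fin N → EuclideanSpace ℝ (Fin 3)), (∀ (N : ℕ) (i j : Fin N), i ≠ j → δ ≤ dist (x N i) (x N j)) → (∀ R η : ℝ, 0 < η → Filter.Tendsto (fun N : ℕ => (Nat.card {p : Fin N × Fin N // p.1 ≠ p.2 ∧ dist (x N p.1) (x N p.2) ≤ R ∧ ∀ a ∈ P.points, ∀ b ∈ P.points, η ≤ |dist (x N p.1) (x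 N p.2) - dist a b|} : ℝ) / N) Filter.atTop (nhds 0)) → (∀ ε : ℝ, 0 < ε → ∃ θ : ℝ, 0 < θ ∧ ∃ L₀ : ℝ, ∀ L : ℝ, L₀ ≤ L → ∀ᶠ N : ℕ in Filter.atTop, ((Finset.univ.filter (fun i : Fin N => ∑ j : Fin N, Real.exp (-(‖x N j - x N i‖ ^ 2) / L ^ 2) ^ 2 < θ * L ^ 3)).card : ℝ) ≤ ε * N) → (∀ h : EuclideanSpace ℝ (Fin 3) → ℝ, Continuous h → HasCompactSupport h → (∀ ξ ∈ tsupport h, ξ ≠ 0 ∧ ∀ k : EuclideanSpace ℝ (Fin 3), (∀ g ∈ P.lattice, ∃ n : ℤ, inner ℝ k g = (n : ℝ)) → ‖ξ‖ ≠ ‖k‖) → ∀ ε θ : ℝ, 0 < ε → 0 < θ → ∃ L₁ : ℝ, ∀ L : ℝ, L₁ ≤ L → ∀ᶠ N : ℕ in Filter.atTop, ((Finset.univ.filter (fun i : Fin N => θ * L ^ 3 ≤ ∑ j : Fin N, Real.exp (-(‖x N j - x N i‖ ^ 2) / L ^ 2) ^ 2 ∧ ε * ∑ j : Fin N, Real.exp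 (-(‖x N j - x N i‖ ^ 2) / L ^ 2) ^ 2 < ∫ ξ, h ξ * ‖∑ j : Fin N, (Real.exp (-(‖x N j - x N i‖ ^ 2) / L ^ 2) : ℂ) * Complex.exp (2 * Real.pi * Complex.I * (inner ℝ ξ (x N j - x N i) : ℂ))‖ ^ 2)).card : ℝ) ≤ ε * N) → (∃ hf : ℕ → (EuclideanSpace ℝ (Fin 3) → ℝ), (∀ m : ℕ, Continuous (hf m) ∧ HasCompactSupport (hf m) ∧ ∀ ξ ∈ tsupport (hf m), ξ ≠ 0 ∧ ∀ k : EuclideanSpace ℝ (Fin 3), (∀ g ∈ P.lattice, ∃ n : ℤ, inner ℝ k g = (n : ℝ)) → ‖ξ‖ ≠ ‖k‖) ∧ ∀ h : EuclideanSpace ℝ (Fin 3) → ℝ, Continuous h → HasCompactSupport h → (∀ ξ ∈ tsupport h, ξ ≠ 0 ∧ ∀ k : EuclideanSpace ℝ (Fin 3), (∀ g ∈ P.lattice, ∃ n : ℤ, inner ℝ k g = (n : ℝ)) → ‖ξ‖ ≠ ‖k‖) → ∀ ε : ℝ, 0 < ε → ∃ m : ℕ, ∀ (n : ℕ) (y :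 Fin n → EuclideanSpace ℝ (Fin 3)) (c : Fin n → ℝ), (∀ i j : Fin n, i ≠ j → δ ≤ dist (y i) (y j)) → |(∫ ξ, h ξ * ‖∑ i : Fin n, (c i : ℂ) * Complex.exp (2 * Real.pi * Complex.I * (inner ℝ ξ (y i) : ℂ))‖ ^ 2) - ∫ ξ, hf m ξ * ‖∑ i : Fin n, (c i : ℂ) * Complex.exp (2 * Real.pi * Complex.I * (inner ℝ ξ (y i) : ℂ))‖ ^ 2| ≤ ε * ∑ i : Fin n, c i ^ 2) → ∃ (φ : ℕ → ℕ) (τ : ℕ → EuclideanSpace ℝ (Fin 3)), StrictMono φ ∧ (∀ j : ℕ, ∃ i : Fin (φ j), x (φ j) i + τ j = 0) ∧ (∀ R η : ℝ, 0 < η → ∀ᶠ j : ℕ in Filter.atTop, ∀ i i' : Fin (φ j), i ≠ i' → ‖x (φ j) i + τ j‖ ≤ R → ‖x (φ j) i' + τ j‖ ≤ R → ∃ a ∈ P.points, ∃ b ∈ P.points, |dist (x (φ j) i + τ j) (x (φ j) i' + τ j) - dist a b| < η) ∧ (∃ L : ℕ → ℝ, Filter.Tendsto L Filter.atTop Filter.atTop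 ∧ ∀ h : EuclideanSpace ℝ (Fin 3) → ℝ, Continuous h → HasCompactSupport h → (∀ ξ ∈ tsupport h, ξ ≠ 0 ∧ ∀ k : EuclideanSpace ℝ (Fin 3), (∀ g ∈ P.lattice, ∃ n : ℤ, inner ℝ k g = (n : ℝ)) → ‖ξ‖ ≠ ‖k‖) → ∀ ε : ℝ, 0 < ε → ∀ᶠ t : ℕ in Filter.atTop, ∀ᶠ j : ℕ in Filter.atTop, (∫ ξ, h ξ * ‖∑ i : Fin (φ j), (Real.exp (-(‖x (φ j) i + τ j‖ ^ 2) / L t ^ 2) : ℂ) * Complex.exp (2 * Real.pi * Complex.I * (inner ℝ ξ (x (φ j) i + τ j) : ℂ))‖ ^ 2) ≤ ε * ∑ i : Fin (φ j), Real.exp (-(‖x (φ j) i + τ j‖ ^ 2) / L t ^ 2) ^ 2) := by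
  intro P δ hδ x HC S2 DENSE QUIET APPROX
  obtain ⟨hf, hfA, hfapp⟩ := APPROX
  obtain ⟨ctr, hE, L, hL, hQ⟩ :=
    HcpRigidityDiagonalCentres.diagonalCentres_core (S := P.points) hδ x HC S2
    (fun h : EuclideanSpace ℝ (Fin 3) → ℝ => Continuous h ∧ HasCompactSupport h ∧
      ∀ ξ ∈ tsupport h, ξ ≠ 0 ∧ ∀ k : EuclideanSpace ℝ (Fin 3),
        (∀ g ∈ P.lattice, ∃ n : ℤ, inner ℝ k g = (n : ℝ)) → ‖ξ‖ ≠ ‖k‖)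
    (fun (h : EuclideanSpace ℝ (Fin 3) → ℝ) (n : ℕ) (y : Fin n → EuclideanSpace ℝ (Fin 3))
        (c : Fin n → ℝ) => ∫ ξ, h ξ * ‖∑ i : Fin n, (c i : ℂ) *
          Complex.exp (2 * Real.pi * Complex.I * (inner ℝ ξ (y i) : ℂ))‖ ^ 2)
    (fun (L : ℝ) (v : EuclideanSpace ℝ (Fin 3)) => Real.exp (-(‖v‖ ^ 2) / L ^ 2))
    DENSE (fun h hA ε θ hε hθ => QUIET h hA.1 hA.2.1 hA.2.2 ε θ hε hθ)
    ⟨hf, hfA, fun h hA ε hε => hfapp h hA.1 hA.2.1 hA.2.2 ε hε⟩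
  refine ⟨fun j => j + 1, fun j => -x (j + 1) (ctr j), fun a b hab => Nat.succ_lt_succ hab,
    fun j => ⟨ctr j, add_neg_cancel _⟩, ?_, L, hL, ?_⟩
  · intro R η hη
    filter_upwards [hE R η hη] with j hj i i' hii' hi hi'
    rw [← sub_eq_add_neg, ← dist_eq_norm] at hi hi'
    rw [← sub_eq_add_neg, ← sub_eq_add_neg, dist_sub_right]
    exact hj i i' hii' hi hi'
  · intro h hh hhs hha ε hε
    filter_upwards [hQ h ⟨hh, hhs, hha⟩ ε hε] with t ht
    filter_upwards [ht] with j hj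
    simp only [← sub_eq_add_neg]
    exact hj

end Summit.AtomisticToContinuum.Crystallization.Theorems
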